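import Summits.BirchSwinnertonDyer.Rank1Residual.X11b.ClassClosureCoefficientCertificate
import Summits.BirchSwinnertonDyer.Rank1Residual.X11b.ClassClosureCertificateNewform
import Summits.BirchSwinnertonDyer.Rank1Residual.Partition.MainConjectures
import HarnessLib

/-!
# Class X11b = N8/O2 (lane CLASS-CLOSURE, seat `cc-typer-3`): the (ram) lever with the regulator
# input REPLACED by the `p`-adic `L`-function ORDER-OF-VANISHING certificate `[T^{1+e}] L ≠ 0`, the
# (ram) MINIMAL PAIRS, and the N8 one-statement at `p ≥ 5` in coefficient currency (cell `b2b-bsdres`)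

HONEST FRAMING (verbatim, cell `b2b-bsdres`, run/shared/lean/b2b/bsd-rank1-residual/): the goal of
the cell is to DELETE the COMBINATION-SHAPED residual classes for ALL analytic-rank `≤ 1` curves
over `ℚ` — "full BSD formula for every rank `≤ 1` curve in class `C`" assembled STRICTLY from
published theorems — so that the rank-`≤ 1` remainder becomes exactly the CONSTRUCTION-SHAPED
classes, which are TYPED (missing-input Props), NOT attempted; this is not "finishing BSD".
Lane CLASS-CLOSURE: prove what is provable now; shrink each hard class to its core with data; no
claim beyond stated classes. THEOREMS ONLY (no definition, no named fact, no `sorry`); nothing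
booked; no label / RESIDUAL-MAP mark changes; X11b stays CONSTRUCTION-SHAPED (O2 OPEN at `p = 3`);
every theorem is CONDITIONAL on the named published facts and the per-pair certificates it lists;
certificate rows are EVIDENCE / instrumentation (their worth = referee A's / the x11b3 lead's
ruling); Schneider's conjecture is NEVER asserted class-wide; at `p = 3` this seat types nothing of
the x11b3 team's record (the split-`3` residue keeps its conjecture; readings at `3` are theirs).

## What this file does

The (ram) lever of `ClassClosureTyped` / `ClassClosureDisegniLever` (Skinner 2016 Thm. A main
conjecture EQUALITY on (irr)+(ram) + Jones / Stein–Wuthrich Thm. 6.1 + Disegni 2020 Thm. 1 relative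
leading term) has ONE per-pair input, `RegulatorNonvanishingAt W p` (REGMULT row). x11c
(`BDPRouteRegulatorCertificate` §5) showed that, granted Disegni's display at the pair, this input has
an EQUIVALENT shape on the `p`-adic `L`-function side: `[T¹]L ≠ 0` (non-split) / `[T²]L ≠ 0` (split)
for THE Mazur–Tate–Teitelbaum function — the ORDER OF VANISHING is exactly `1 + e`. GEN 3 fed that
shape to the `μ`-road (`ClassClosureCoefficientCertificate`, ¬Ram); this file feeds it to the (ram)
road and closes the square:
* `coeff_ne_zero_of_norm_C_mul_eq_one`, `coeffCert_of_unitCoeffAt_one` — bookkeeping: a unit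
  coefficient of `ϖ·L` at index `1 + e` (iw-1's `Iwasawa.UnitCoeffAt W p 1`, ONE newform suffices by
  strong multiplicity one) is an order-of-vanishing certificate;
* `schneiderHalf_split_of_relativeLeadingTerm_of_coeff_two_ne_zero` — class level, split, ANY odd
  `p`: the EVIDENCE-labelled conjecture `RelativeExceptionalLeadingTermAt W p` + `[T²]L ≠ 0` ⟹ the
  split Schneider half (the conjecture-fed twin of GEN 3's `schneiderHalf_split_of_coeff_two_ne_zero`);
* `bsdp_of_ram_of_coeff_ne_zero` — **THE COEFF ROAD ON THE (ram) ATOM**: X11b ∧ `Ram W p` +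
  (`[T¹]L ≠ 0` if non-split — ANY odd `p` — | `p ≥ 5` ∧ `[T²]L ≠ 0` if split) ⟹ `BSD(E,p)` from the
  lever's named facts; the second multiplicative prime of Disegni's (∗) IS the (ram) prime. Compared
  with census-ctyper-2's one-node theorem `ClassClosure.bsdp_of_ram_of_census` (input = the typed
  census RELATION X11b-1 at the pair: order clause (i) AND identity clause (ii) with exact constant),
  the per-pair input here is clause (i) ALONE — clause (ii) is Disegni's Thm. 1 IN PRINT on this locus;
* `bsdp_of_ram_split_of_conjecture_of_coeff_two_ne_zero` — split, ANY odd `p`, (ram): the conjecture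
  replaces `p ≥ 5` (the O2 residue's consumer in coefficient currency; CONDITIONAL on an unproved
  conjecture; at `p = 3` a reading of the x11b3 team, not of this seat);
* `bsdp_of_ram_of_unitCoeffAt_one` — **(ram) MINIMAL PAIRS**: ONE certificate
  `Iwasawa.UnitCoeffAt W p 1` ⟹ `BSD(E,p)` (non-split any odd `p`; split `p ≥ 5`) — no REGMULT row,
  no `μ`, no Hida/EPW/Wan facts (the (ram) twin of `ClassClosureMinimalPair`, which serves ¬Ram);
* `bsdp_of_classX11b_five_le_of_ram_or_muAnZeroAt_of_coeff_ne_zero` — **N8 @ `p ≥ 5`, ONE STATEMENT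
  in coefficient currency** (the twin of p275908 `bsdp_of_classX11b_five_le_of_ram_or_muAnZeroAt`):
  (α) `Ram W p` ∨ (`Surj W p` ∧ `MuAnZeroAt W p`), (β) the order-of-vanishing certificate, (γ) at a
  split `p` off (ram): a second multiplicative prime ∨ `RelativeExceptionalLeadingTermAt W p`
  ⟹ `BSD(E,p)` — BOTH per-pair inputs of every N8 cell at `p ≥ 5` are then statements about the
  coefficients of `ϖ·L_p(E)` (a REGMULT row is an independent cross-check); `forall_…` forms.
Instrument note (EVIDENCE): order of vanishing `r + e` is what the census reads with PARI `ellpadicL`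
(X11-REPORT: 2 279/2 279 rows `p ‖ N`, `N ≤ 1000`); the B-5 fold certifies coefficients mod `p` only
(enough exactly on minimal pairs). Nothing at `p = 3` is claimed by this seat; nothing booked.
References: [Skinner2016PacificMC] Thm. A; [SteinWuthrich2013] Thm. 6.1, §4.2; [Disegni2020] Thm. 1,
(∗); [MazurTateTeitelbaum1986Invent] §I.13, §II.10; [EmertonPollackWeston2006]; [Wan2015] Thm. 4;
[AtkinLehner1970] Thm. 4; [Miller2011LMS] Def. 1.1; HOME/class-closure/O2/TYPER-3.md §10.
-/

set_option autoImplicit false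

noncomputable section

open scoped Classical MatrixGroups ModularForm

open CongruenceSubgroup WeierstrassCurve Literature.NumberTheory.EllipticCurves
  Literature.NumberTheory.EllipticCurves.ModularForms
  Literature.NumberTheory.EllipticCurves.Rank1Residual
  Literature.NumberTheory.EllipticCurves.Rank1Residual.Typed
  Literature.NumberTheory.EllipticCurves.Skinner2016
  Literature.NumberTheory.EllipticCurves.SteinWuthrich2013
  Literature.NumberTheory.EllipticCurves.Wuthrich2014
  Literature.NumberTheory.EllipticCurves.Disegni2020
  Literature.NumberTheory.EllipticCurves.GreenbergVatsal2000
  Literature.NumberTheory.EllipticCurves.EmertonPollackWeston2006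
  Summit.BirchSwinnertonDyer.Rank1Residual.X1.MuLambda

namespace Summit.BirchSwinnertonDyer.Rank1Residual.X11b.ClassClosure

open X11a

section Bookkeeping

variable (W : WeierstrassCurve ℚ) [W.IsElliptic] [W.IsGloballyMinimal] (p : ℕ) [Fact p.Prime]

/-- A unit coefficient of `c·L` is a nonzero coefficient of `L`. [folklore] -/
theorem coeff_ne_zero_of_norm_C_mul_eq_one {c : ℚ_[p]} {L : PowerSeries ℚ_[p]} {k : ℕ}
    (h : ‖PowerSeries.coeff k (PowerSeries.C c * L)‖ = 1) : PowerSeries.coeff k L ≠ 0 := by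
  intro h0
  rw [PowerSeries.coeff_C_mul, h0, mul_zero, norm_zero] at h
  exact zero_ne_one h

/-- **A minimal-pair certificate is an order-of-vanishing certificate.** `Iwasawa.UnitCoeffAt W p 1`
(the coefficient of index `1` — non-split — resp. `2` — split — of `ϖ·L` is a `p`-adic unit, for every
newform of `W` and its period ratio) gives `[T¹]L ≠ 0` resp. `[T²]L ≠ 0` for THE Mazur–Tate–Teitelbaum
function of EVERY newform of `W` at every level: by strong multiplicity one
(`IsNewformOf.level_eq_level`, `IsNewformOf.unique`) any newform is the one of the modular
parametrisation datum (`hpar`), whose period ratio exists (`exists_rat_mul_realPeriodRat_eq_plusPeriod`).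
Pure bookkeeping; nothing booked. [cite: AtkinLehner1970, Thm. 4]
[cite: MazurTateTeitelbaum1986Invent, §I.14 (shape)] -/
theorem coeffCert_of_unitCoeffAt_one (hpar : nonempty_modularParametrizationData)
    (hU : Iwasawa.UnitCoeffAt W p 1) :
    (¬ W.HasSplitMultiplicativeReductionAtPrime p →
      ∀ {N : ℕ} [NeZero N] (f : CuspForm (Gamma0 N) 2) (L : PowerSeries ℚ_[p]),
        IsNewformOf W f → IsMultPAdicLFunctionOf f p (-1) L → PowerSeries.coeff 1 L ≠ 0) ∧
    (W.HasSplitMultiplicativeReductionAtPrime p →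
      ∀ {N : ℕ} [NeZero N] (f : CuspForm (Gamma0 N) 2) (L : PowerSeries ℚ_[p]),
        IsNewformOf W f → IsSplitMultPAdicLFunctionOf f p L → PowerSeries.coeff 2 L ≠ 0) := by
  haveI : NeZero (W.conductorNorm ℤ) := ⟨(W.conductorNorm_pos_holds).ne'⟩
  obtain ⟨Dm⟩ := hpar W
  obtain ⟨ϖ, -, hϖ, -⟩ := Dm.exists_rat_mul_realPeriodRat_eq_plusPeriod
  refine ⟨fun hns => ?_, fun hs => ?_⟩
  · intro N _ f L hf hL
    obtain rfl : N = W.conductorNorm ℤ := hf.level_eq_level Dm.isNewformOf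
    have hfe : f = Dm.f := hf.unique Dm.isNewformOf
    have hϖf : (ϖ : ℝ) * W.realPeriodRat = plusPeriod f := by rw [hfe]; exact hϖ
    exact coeff_ne_zero_of_norm_C_mul_eq_one p ((hU f hf ϖ hϖf).1 hns L hL)
  · intro N _ f L hf hL
    obtain rfl : N = W.conductorNorm ℤ := hf.level_eq_level Dm.isNewformOf
    have hfe : f = Dm.f := hf.unique Dm.isNewformOf
    have hϖf : (ϖ : ℝ) * W.realPeriodRat = plusPeriod f := by rw [hfe]; exact hϖ
    exact coeff_ne_zero_of_norm_C_mul_eq_one p ((hU f hf ϖ hϖf).2 hs L hL)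

/-- **Class level, SPLIT, ANY odd `p`: the split Schneider half from the conjecture and
`[T²]L ≠ 0`.** For an X11b pair split at `p`: if the lane's EVIDENCE-labelled conjecture
`RelativeExceptionalLeadingTermAt W p` holds at the pair (Disegni's split display without (∗); IN
PRINT at `p ≥ 5` with a second multiplicative prime, `relativeExceptionalLeadingTermAt_of_disegni_of_five_le`)
and THE split Mazur–Tate–Teitelbaum function of every newform of `E` has `[T²]L ≠ 0`, then
Schneider's conjecture holds for every modified §4.2 datum (x11c's datum lemma
`schneiderConjecture_of_coeff_two_ne_zero`; modularity `hpar` supplies the newform and `ϖ > 0`).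
CONDITIONAL on an unproved conjecture; nothing booked.
[cite: Disegni2020, Thm. 1 (§1.2) with hypothesis (∗) removed (shape only; nothing asserted)]
[cite: MazurTateTeitelbaum1986Invent, §II.10] [cite: SteinWuthrich2013, §4.2] -/
theorem schneiderHalf_split_of_relativeLeadingTerm_of_coeff_two_ne_zero
    (hpar : nonempty_modularParametrizationData) (hX : ClassX11b W p)
    (hsplit : W.HasSplitMultiplicativeReductionAtPrime p) (hC : RelativeExceptionalLeadingTermAt W p)
    (hcert : ∀ {N : ℕ} [NeZero N] (f : CuspForm (Gamma0 N) 2) (L : PowerSeries ℚ_[p]),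
      IsNewformOf W f → IsSplitMultPAdicLFunctionOf f p L → PowerSeries.coeff 2 L ≠ 0) :
    ∀ (Dq : TateParameterData W p) (Dh : PAdicHeightData W p),
      IsSplitMultCanonical Dh Dq → SchneiderConjecture Dh := by
  intro Dq Dh hDh
  obtain ⟨hr, hp2, -, -⟩ := hX
  haveI : NeZero (W.conductorNorm ℤ) := ⟨(W.conductorNorm_pos_holds).ne'⟩
  obtain ⟨Dm⟩ := hpar W
  obtain ⟨ϖ, hϖpos, hϖ, -⟩ := Dm.exists_rat_mul_realPeriodRat_eq_plusPeriod
  obtain ⟨L, hL⟩ := exists_isSplitMultPAdicLFunctionOf hsplit Dm.isNewformOf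
  obtain ⟨s, u', -, hDis⟩ := hC hp2 hsplit hr Dm.isNewformOf ϖ hϖpos.ne' hϖ Dq L hL Dh hDh
  have hϖ0 : ((ϖ : ℚ) : ℚ_[p]) ≠ 0 := by exact_mod_cast hϖpos.ne'
  exact schneiderConjecture_of_coeff_two_ne_zero W p hϖ0 Dq Dh u' hDis
    (hcert Dm.f L Dm.isNewformOf hL)

end Bookkeeping

/-! ### §1 The COEFF road on the (ram) atom -/

section Ram

variable (W : WeierstrassCurve ℚ) [W.IsElliptic] [W.IsGloballyMinimal] (p : ℕ) [Fact p.Prime]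

/-- **THE COEFF ROAD ON THE (ram) ATOM OF N8/O2.** For an X11b pair (`ord_{s=1} L(E,s) = 1`, `p`
odd, `p ‖ N`, `E[p]` irreducible) with a (ram) prime (`Ram W p`): `BSD(E,p)` from the PUBLISHED named
facts of the lever — Skinner 2016 Thm. A (`hA`, main-conjecture equality on (irr)+(ram)),
Stein–Wuthrich 2013 Thm. 6.1 ×2 (`hJn`, `hJs`) and §4.2 height existence ×2 (`hHn`, `hHs`), Disegni
2020 Thm. 1 (`hD`), GZK (`hGZK`), modularity (`hpar`) — and ONE per-pair input, the ORDER-OF-VANISHING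
certificate of THE Mazur–Tate–Teitelbaum function: `[T¹]L ≠ 0` if `E` is non-split at `p` (`hc1`;
ANY odd `p`), `[T²]L ≠ 0` and `p ≥ 5` if split (`hc2`, `hp5`: Disegni's (∗), whose second
multiplicative prime IS the (ram) prime). The regulator input of `bsdp_of_leverLocus_of_regulatorNonvanishing`
is DERIVED (x11c's `regulatorNonvanishingAt_of_coeff_one_ne_zero`; GEN 3's
`schneiderHalf_split_of_coeff_two_ne_zero`). Versus census-ctyper-2's `ClassClosure.bsdp_of_ram_of_census`
(input: the typed census relation, order clause AND identity clause): here the identity clause is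
Disegni's theorem in print and only the order clause is asked of the pair. NO `μ`, NO `#Ш_an` /
Tamagawa / anomalous / partner hypothesis. CONDITIONAL; nothing booked; X11b stays
CONSTRUCTION-SHAPED. [cite: Skinner2016PacificMC, Thm. A (§1), §3.2–3.3]
[cite: SteinWuthrich2013, Thm. 6.1 (p. 20), §4.2] [cite: Disegni2020, Thm. 1 (§1.2), hypothesis (∗)]
[cite: MazurTateTeitelbaum1986Invent, §I.13 and §II.10] [cite: Miller2011LMS, Def. 1.1] -/
theorem bsdp_of_ram_of_coeff_ne_zero (hA : thmA_charIdeal_multiplicative)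
    (hJn : thm61_nonsplitMultiplicative) (hJs : thm61_splitMultiplicative)
    (hHn : exists_isMultCanonical) (hHs : exists_isSplitMultCanonical)
    (hD : thm1_padicBSD_rankOne_multiplicative)
    (hGZK : rank_eq_analyticRank_of_analyticRank_le_one) (hpar : nonempty_modularParametrizationData)
    (hX : ClassX11b W p) (hram : Ram W p)
    (hc1 : ¬ W.HasSplitMultiplicativeReductionAtPrime p →
      ∀ {N : ℕ} [NeZero N] (f : CuspForm (Gamma0 N) 2) (L : PowerSeries ℚ_[p]),
        IsNewformOf W f → IsMultPAdicLFunctionOf f p (-1) L → PowerSeries.coeff 1 L ≠ 0)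
    (hp5 : W.HasSplitMultiplicativeReductionAtPrime p → 5 ≤ p)
    (hc2 : W.HasSplitMultiplicativeReductionAtPrime p →
      ∀ {N : ℕ} [NeZero N] (f : CuspForm (Gamma0 N) 2) (L : PowerSeries ℚ_[p]),
        IsNewformOf W f → IsSplitMultPAdicLFunctionOf f p L → PowerSeries.coeff 2 L ≠ 0) :
    BSDp W p := by
  by_cases hsplit : W.HasSplitMultiplicativeReductionAtPrime p
  · -- split: Disegni's (∗) — the second multiplicative prime is the (ram) prime
    have hm : ∃ (m : ℕ) (_ : Fact m.Prime), m ≠ p ∧ W.HasMultiplicativeReductionAtPrime m := by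
      obtain ⟨ℓ, hℓ, hℓp, hmℓ, -⟩ := hram
      exact ⟨ℓ, hℓ, hℓp, hmℓ⟩
    exact bsdp_of_ram_split_of_five_le_of_schneider W p hA hJs hHs hGZK hpar
      (fun hf ϖ hϖ0 hϖ hp5' hm' Dq L hL Dh hDh =>
        thm1_padicBSD_rankOne_multiplicative.split hD W p hX.2.1 hX.2.2.1 hX.1 hf ϖ hϖ0 hϖ hsplit hp5'
          hm' Dq L hL Dh hDh)
      hX hsplit hram (hp5 hsplit)
      (schneiderHalf_split_of_coeff_two_ne_zero W p hD hpar hX hsplit (hp5 hsplit) hm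
        (fun f L hf hL => hc2 hsplit f L hf hL))
  · -- non-split: ANY odd `p`
    exact bsdp_of_ram_nonsplit_of_schneider W p hA hJn hHn hGZK hpar
      (fun hf ϖ hϖ0 hϖ q hq0 hq1 hqj L hL Dh hDh =>
        thm1_padicBSD_rankOne_multiplicative.nonsplit hD W p hX.2.1 hX.2.2.1 hX.1 hf ϖ hϖ0 hϖ hsplit
          hq0 hq1 hqj L hL Dh hDh)
      hX hsplit hram
      (regulatorNonvanishingAt_of_coeff_one_ne_zero W p hD hpar hX hsplit
        (fun f L hf hL => hc1 hsplit f L hf hL)).1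

/-- **Split, ANY odd `p`, (ram): the residue's consumer in coefficient currency.** For an X11b pair
SPLIT at the odd prime `p` with a (ram) prime: `BSD(E,p)` from Skinner 2016 Thm. A (as the typed main
conjecture at the pair, `X2.mazurMainConjectureAt_of_thmA`), Stein–Wuthrich Thm. 6.1 split + §4.2,
GZK, modularity, the EVIDENCE-labelled CONJECTURE `RelativeExceptionalLeadingTermAt W p` (in place of
Disegni's theorem and its `p ≥ 5`) and the certificate `[T²]L ≠ 0`. The coefficient twin of
`bsdp_three_of_splitThreeResidue_of_conjecture` (there: the REG₃ row). CONDITIONAL on an UNPROVED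
conjecture; nothing booked; at `p = 3` the reading belongs to the x11b3 team.
[cite: Skinner2016PacificMC, Thm. A (§1) with §3.2–3.3] [cite: SteinWuthrich2013, Thm. 6.1 (p. 20) and §4.2]
[cite: Disegni2020, Thm. 1 (§1.2) with hypothesis (∗) removed (shape only; nothing asserted)]
[cite: Miller2011LMS, Def. 1.1] -/
theorem bsdp_of_ram_split_of_conjecture_of_coeff_two_ne_zero (hA : thmA_charIdeal_multiplicative)
    (hJs : thm61_splitMultiplicative) (hHs : exists_isSplitMultCanonical)
    (hGZK : rank_eq_analyticRank_of_analyticRank_le_one) (hpar : nonempty_modularParametrizationData)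
    (hX : ClassX11b W p) (hsplit : W.HasSplitMultiplicativeReductionAtPrime p) (hram : Ram W p)
    (hC : RelativeExceptionalLeadingTermAt W p)
    (hc2 : ∀ {N : ℕ} [NeZero N] (f : CuspForm (Gamma0 N) 2) (L : PowerSeries ℚ_[p]),
      IsNewformOf W f → IsSplitMultPAdicLFunctionOf f p L → PowerSeries.coeff 2 L ≠ 0) :
    BSDp W p := by
  have hpP : p.Prime := Fact.out
  have hp3 : 3 ≤ p := by
    have h2 : 2 ≤ p := hpP.two_le
    have hne : p ≠ 2 := hX.2.1
    omega
  exact bsdp_of_mazurMainConjectureAt_of_split_of_conjecture_of_schneider W p hJs hHs hGZK hpar hX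
    hsplit (X2.mazurMainConjectureAt_of_thmA hA hp3 hX.2.2.1 hX.2.2.2 hram) hC
    (schneiderHalf_split_of_relativeLeadingTerm_of_coeff_two_ne_zero W p hpar hX hsplit hC hc2)

/-- **(ram) MINIMAL PAIRS.** For an X11b pair with a (ram) prime: ONE finite certificate
`Iwasawa.UnitCoeffAt W p 1` (the coefficient of index `1 + e` of `ϖ·L_p(E)` is a `p`-adic unit — iw-1's
"minimal pair" shape, instrument B-5) ⟹ `BSD(E,p)` from the lever's named facts — non-split at ANY
odd `p`, split at `p ≥ 5` (`hp5`, Disegni's (∗)). NO regulator row, NO `μ`, NO Hida/EPW/Wan fact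
(contrast `ClassClosureMinimalPair.bsdp_of_unitCoeffAt_one`, the ¬Ram twin, which needs the squeeze for
the main conjecture and Kato–Wuthrich A32; here Skinner's Thm. A is the main conjecture). CONDITIONAL;
nothing booked; X11b stays CONSTRUCTION-SHAPED. [cite: Skinner2016PacificMC, Thm. A]
[cite: SteinWuthrich2013, Thm. 6.1, §4.2] [cite: Disegni2020, Thm. 1 (§1.2), hypothesis (∗)]
[cite: GreenbergVatsal2000, p. 2–3, (2) (shape of the certificate)] [cite: Miller2011LMS, Def. 1.1] -/
theorem bsdp_of_ram_of_unitCoeffAt_one (hA : thmA_charIdeal_multiplicative)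
    (hJn : thm61_nonsplitMultiplicative) (hJs : thm61_splitMultiplicative)
    (hHn : exists_isMultCanonical) (hHs : exists_isSplitMultCanonical)
    (hD : thm1_padicBSD_rankOne_multiplicative)
    (hGZK : rank_eq_analyticRank_of_analyticRank_le_one) (hpar : nonempty_modularParametrizationData)
    (hX : ClassX11b W p) (hram : Ram W p)
    (hp5 : W.HasSplitMultiplicativeReductionAtPrime p → 5 ≤ p) (hU : Iwasawa.UnitCoeffAt W p 1) :
    BSDp W p :=
  bsdp_of_ram_of_coeff_ne_zero W p hA hJn hJs hHn hHs hD hGZK hpar hX hram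
    (coeffCert_of_unitCoeffAt_one W p hpar hU).1 hp5 (coeffCert_of_unitCoeffAt_one W p hpar hU).2

end Ram

/-! ### §2 N8 at `p ≥ 5`: ONE STATEMENT in coefficient currency (both roads) -/

section Five

variable (W : WeierstrassCurve ℚ) [W.IsElliptic] [W.IsGloballyMinimal] (p : ℕ) [Fact p.Prime]

/-- **N8 AT `p ≥ 5`, BOTH ROADS, COEFFICIENT CURRENCY** (the twin of
`bsdp_of_classX11b_five_le_of_ram_or_muAnZeroAt`, p275908). For an X11b pair with `p ≥ 5`:
`BSD(E,p)` from NAMED PUBLISHED FACTS ONLY — Skinner 2016 Thm. A (`hA`, (ram) road), x11a's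
weight-`k` chain facts (Hida member, MTT weight `k`, EPW 3.1.1 / Thm 1 / 5.1.3 bounded, Wan Thm 4
rational bounded, Deligne–Serre 6.1, Hida 3.26, Kato–Wuthrich A32; `μ`-road), Stein–Wuthrich Thm 6.1
×2 + §4.2 ×2, Disegni 2020 Thm 1, GZK, modularity — given (α) `Ram W p` OR (`Surj W p` AND
`MuAnZeroAt W p`), (β) the ORDER-OF-VANISHING certificate of THE Mazur–Tate–Teitelbaum function
(`[T¹]L ≠ 0` non-split / `[T²]L ≠ 0` split), and (γ) IF `E` is split at `p` and NOT (ram): a second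
multiplicative prime (Disegni's (∗)) OR the EVIDENCE-labelled conjecture
`RelativeExceptionalLeadingTermAt W p`. So BOTH per-pair inputs of every N8 cell at `p ≥ 5` are
statements about the coefficients of `ϖ·L_p(E)`. NO `#Ш_an` / Tamagawa / anomalous / partner
hypothesis; NO regulator row. CONDITIONAL (on an unproved conjecture only where (γ)'s second
disjunct is used); nothing booked; X11b stays CONSTRUCTION-SHAPED.
[cite: Skinner2016PacificMC, Thm. A] [cite: EmertonPollackWeston2006, Thm. 1, Thm. 3.1.1, Thm. 5.1.3]
[cite: Wan2015, Thm. 4] [cite: Wuthrich2014, Thm. 3 (p. 382) and Cor. 19 proof (p. 399)]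
[cite: SteinWuthrich2013, Thm. 6.1 (p. 20), §4.2] [cite: Disegni2020, Thm. 1 (§1.2), hypothesis (∗)]
[cite: MazurTateTeitelbaum1986Invent, §I.13 and §II.10] [cite: Miller2011LMS, Def. 1.1] -/
theorem bsdp_of_classX11b_five_le_of_ram_or_muAnZeroAt_of_coeff_ne_zero
    (hA : thmA_charIdeal_multiplicative)
    (hHida : hida_exists_congruent_ordinary_newform_of_multiplicative)
    (hMTT : exists_isCycPAdicLFunctionWeightK)
    (h311 : thm311_cotorsion_weightK_member) (hT1a : thm1_muAlg_of_weightK_member)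
    (hT2 : Wan2015.thm4_rational_weightK_member_of_bdd)
    (hT1b : thm513_transfer_from_weightK_member_of_bdd)
    (h61 : DeligneSerre1974.thm61_exists_adicGaloisRep) (h326 : Hida2000_thm326_ordinary)
    (hKato : kato_charIdeal_dvd_multiplicative_of_surjective)
    (hJn : thm61_nonsplitMultiplicative) (hJs : thm61_splitMultiplicative)
    (hHn : exists_isMultCanonical) (hHs : exists_isSplitMultCanonical)
    (hD : thm1_padicBSD_rankOne_multiplicative)
    (hGZK : rank_eq_analyticRank_of_analyticRank_le_one) (hpar : nonempty_modularParametrizationData)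
    (hX : ClassX11b W p) (hp : 5 ≤ p) (hroad : Ram W p ∨ (Surj W p ∧ MuAnZeroAt W p))
    (hc1 : ¬ W.HasSplitMultiplicativeReductionAtPrime p →
      ∀ {N : ℕ} [NeZero N] (f : CuspForm (Gamma0 N) 2) (L : PowerSeries ℚ_[p]),
        IsNewformOf W f → IsMultPAdicLFunctionOf f p (-1) L → PowerSeries.coeff 1 L ≠ 0)
    (hc2 : W.HasSplitMultiplicativeReductionAtPrime p →
      ∀ {N : ℕ} [NeZero N] (f : CuspForm (Gamma0 N) 2) (L : PowerSeries ℚ_[p]),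
        IsNewformOf W f → IsSplitMultPAdicLFunctionOf f p L → PowerSeries.coeff 2 L ≠ 0)
    (hγ : W.HasSplitMultiplicativeReductionAtPrime p → ¬ Ram W p →
      (∃ (m : ℕ) (_ : Fact m.Prime), m ≠ p ∧ W.HasMultiplicativeReductionAtPrime m) ∨
        RelativeExceptionalLeadingTermAt W p) :
    BSDp W p := by
  by_cases hram : Ram W p
  · -- the (ram) road (also when `hroad` offers the `μ`-road: (ram) needs no `μ`)
    exact bsdp_of_ram_of_coeff_ne_zero W p hA hJn hJs hHn hHs hD hGZK hpar hX hram hc1 (fun _ => hp)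
      hc2
  · obtain ⟨hsurj, hμ⟩ := hroad.resolve_left hram
    have hMC : X2.MazurMainConjectureAt W p :=
      mazurMainConjectureAt_of_namedFacts_bdd W p hHida hMTT h311 hT1a hT2 hT1b h61 h326 hKato hpar
        hp hX.2.2.1 hsurj hμ
    by_cases hsplit : W.HasSplitMultiplicativeReductionAtPrime p
    · rcases hγ hsplit hram with hm | hC
      · -- Disegni's (∗): T-WK in coefficient currency (GEN 3)
        exact bsdp_of_namedFacts_bdd_of_coeff_ne_zero W p hHida hMTT h311 hT1a hT2 hT1b h61 h326
          hKato hJn hJs hHn hHs hD hGZK hpar hX hp hsurj hμ hc1 (fun _ => hm) hc2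
      · -- the conjecture: split clause through `RelativeExceptionalLeadingTermAt W p`
        exact bsdp_of_mazurMainConjectureAt_of_split_of_conjecture_of_schneider W p hJs hHs hGZK hpar
          hX hsplit hMC hC
          (schneiderHalf_split_of_relativeLeadingTerm_of_coeff_two_ne_zero W p hpar hX hsplit hC
            (fun f L hf hL => hc2 hsplit f L hf hL))
    · exact bsdp_of_namedFacts_bdd_of_coeff_ne_zero W p hHida hMTT h311 hT1a hT2 hT1b h61 h326
        hKato hJn hJs hHn hHs hD hGZK hpar hX hp hsurj hμ hc1 (fun hs => absurd hs hsplit) hc2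

end Five

/-! ### §3 Class level -/

/-- **N8/O2 ∩ (ram): `BSD(E,p)` ⇐ the lever's named facts + the order-of-vanishing certificate**
(non-split: ANY odd `p`; split: `p ≥ 5`) — the ∀-form of `bsdp_of_ram_of_coeff_ne_zero`. No label
change (referee A / x11b3 lead); CONDITIONAL; nothing booked; X11b stays CONSTRUCTION-SHAPED.
[cite: Skinner2016PacificMC, Thm. A] [cite: SteinWuthrich2013, Thm. 6.1, §4.2]
[cite: Disegni2020, Thm. 1 (§1.2), hypothesis (∗)] [cite: Miller2011LMS, Def. 1.1] -/
theorem forall_bsdp_of_ram_of_coeff_ne_zero (hA : thmA_charIdeal_multiplicative)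
    (hJn : thm61_nonsplitMultiplicative) (hJs : thm61_splitMultiplicative)
    (hHn : exists_isMultCanonical) (hHs : exists_isSplitMultCanonical)
    (hD : thm1_padicBSD_rankOne_multiplicative)
    (hGZK : rank_eq_analyticRank_of_analyticRank_le_one) (hpar : nonempty_modularParametrizationData) :
    ∀ (W : WeierstrassCurve ℚ) [W.IsElliptic] [W.IsGloballyMinimal] (p : ℕ) [Fact p.Prime],
      ClassX11b W p → Ram W p →
      (¬ W.HasSplitMultiplicativeReductionAtPrime p →
        ∀ {N : ℕ} [NeZero N] (f : CuspForm (Gamma0 N) 2) (L : PowerSeries ℚ_[p]),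
          IsNewformOf W f → IsMultPAdicLFunctionOf f p (-1) L → PowerSeries.coeff 1 L ≠ 0) →
      (W.HasSplitMultiplicativeReductionAtPrime p → 5 ≤ p) →
      (W.HasSplitMultiplicativeReductionAtPrime p →
        ∀ {N : ℕ} [NeZero N] (f : CuspForm (Gamma0 N) 2) (L : PowerSeries ℚ_[p]),
          IsNewformOf W f → IsSplitMultPAdicLFunctionOf f p L → PowerSeries.coeff 2 L ≠ 0) →
      BSDp W p :=
  fun W _ _ p _ hX hram hc1 hp5 hc2 =>
    bsdp_of_ram_of_coeff_ne_zero W p hA hJn hJs hHn hHs hD hGZK hpar hX hram hc1 hp5 hc2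

/-- **N8 ∩ {`p ≥ 5`}: `BSD(E,p)` ⇐ named published facts + (α) `Ram` ∨ (`Surj` ∧ `μ^an = 0`) +
(β) the order-of-vanishing certificate + (γ) at a split `p` off (ram) a second multiplicative prime ∨
the conjecture** — the ∀-form of `bsdp_of_classX11b_five_le_of_ram_or_muAnZeroAt_of_coeff_ne_zero`.
No label change (referee A / x11b3 lead); CONDITIONAL; nothing booked; X11b stays CONSTRUCTION-SHAPED.
[cite: Skinner2016PacificMC, Thm. A] [cite: EmertonPollackWeston2006, Thm. 1, Thm. 3.1.1, Thm. 5.1.3]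
[cite: Wan2015, Thm. 4] [cite: SteinWuthrich2013, Thm. 6.1, §4.2] [cite: Disegni2020, Thm. 1 (§1.2), hypothesis (∗)]
[cite: Miller2011LMS, Def. 1.1] -/
theorem forall_bsdp_five_le_of_ram_or_muAnZeroAt_of_coeff_ne_zero (hA : thmA_charIdeal_multiplicative)
    (hHida : hida_exists_congruent_ordinary_newform_of_multiplicative)
    (hMTT : exists_isCycPAdicLFunctionWeightK)
    (h311 : thm311_cotorsion_weightK_member) (hT1a : thm1_muAlg_of_weightK_member)
    (hT2 : Wan2015.thm4_rational_weightK_member_of_bdd)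
    (hT1b : thm513_transfer_from_weightK_member_of_bdd)
    (h61 : DeligneSerre1974.thm61_exists_adicGaloisRep) (h326 : Hida2000_thm326_ordinary)
    (hKato : kato_charIdeal_dvd_multiplicative_of_surjective)
    (hJn : thm61_nonsplitMultiplicative) (hJs : thm61_splitMultiplicative)
    (hHn : exists_isMultCanonical) (hHs : exists_isSplitMultCanonical)
    (hD : thm1_padicBSD_rankOne_multiplicative)
    (hGZK : rank_eq_analyticRank_of_analyticRank_le_one) (hpar : nonempty_modularParametrizationData) :
    ∀ (W : WeierstrassCurve ℚ) [W.IsElliptic] [W.IsGloballyMinimal] (p : ℕ) [Fact p.Prime],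
      ClassX11b W p → 5 ≤ p → (Ram W p ∨ (Surj W p ∧ MuAnZeroAt W p)) →
      (¬ W.HasSplitMultiplicativeReductionAtPrime p →
        ∀ {N : ℕ} [NeZero N] (f : CuspForm (Gamma0 N) 2) (L : PowerSeries ℚ_[p]),
          IsNewformOf W f → IsMultPAdicLFunctionOf f p (-1) L → PowerSeries.coeff 1 L ≠ 0) →
      (W.HasSplitMultiplicativeReductionAtPrime p →
        ∀ {N : ℕ} [NeZero N] (f : CuspForm (Gamma0 N) 2) (L : PowerSeries ℚ_[p]),
          IsNewformOf W f → IsSplitMultPAdicLFunctionOf f p L → PowerSeries.coeff 2 L ≠ 0) →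
      (W.HasSplitMultiplicativeReductionAtPrime p → ¬ Ram W p →
        (∃ (m : ℕ) (_ : Fact m.Prime), m ≠ p ∧ W.HasMultiplicativeReductionAtPrime m) ∨
          RelativeExceptionalLeadingTermAt W p) →
      BSDp W p :=
  fun W _ _ p _ hX hp hroad hc1 hc2 hγ =>
    bsdp_of_classX11b_five_le_of_ram_or_muAnZeroAt_of_coeff_ne_zero W p hA hHida hMTT h311 hT1a hT2
      hT1b h61 h326 hKato hJn hJs hHn hHs hD hGZK hpar hX hp hroad hc1 hc2 hγ

end Summit.BirchSwinnertonDyer.Rank1Residual.X11b.ClassClosure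

end
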